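import Summits.QuantumFields.YangMills.Theorems.BalabanUVNodesK1WindowKOfRunRows

/-!
# Crux K1⁷ — THE WINDOW's BARE COUPLINGS ARE DEF-1's SURVIVORS: under K1⁷ v6's run row (i) every survivor set `Survivors β γ K` contains an explicit initial interval
# `]0, x_K(γ)]`; at the canonical construction ∕ NODE 00's Stage-13 datum the survivor set IS the set of bare couplings whose run of length `K` stays in `]0, γ]`
# (so the K1⁷ window clauses are non-emptiness statements about survivor sets, and K2⁷'s `SurvCont` conjunct is never asked on a trivial domain)

Cell `pub-ymgap`, YM-PLAN Track A (HUMAN RULING D-0062 ∕ D-0149, director-ym №197 ∕ №207), WIDTH SEAT `pub-ymgap-dag-n13-w4` (g5) on NODE n13 [Balaban1989LargeFieldII]; helper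
(`--supports`, count-neutral) for crux K1⁷ `StabilityBAtRecordR13SepCoPH` = stmt-QuantumFields-20542.  Ninth module of the seat's window lineage; successor of `…K1WindowKOfRunRows` (this
seat, g5: row (i) ALONE ⟹ in-window runs of EVERY length inside ONE window, explicit bare coupling, ladder).

THE POINT.  Two vocabularies for the same set.  The K1⁷ side speaks of WINDOWS: «some bare coupling `g₀` whose run `⟨K, m, g₀⟩` stays in `]0, γ]`» (the crux's `Window`, this seat's
K-indexed and K-uniform windows).  ym-nodeO DEF-1's run letter `RunRemAt` (K2⁷ v6's currency, `…K2NamedJetsRunRemAt`) and the Gaps END roads (`Gaps/EndRunwiseShooting`,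
`Gaps/EndSurvivorExtension`, `Gaps/EndSurvivorCensus`) speak of SURVIVORS: `Survivors β γ K = {x ∈ ]0, γ] : the γ-clamped forward run from x is unclamped up to K}` — the domain on which
DEF-1's (C) conjunct `SurvCont β γ₀ := ∀ k, ContinuousOn (trace k) (Survivors β γ₀ k)` is asked and on which Tietze ∕ the shooting supremum run.  HERE: (§2) for the canonical construction
`modelOf β` — hence (§3) for NODE 00's Stage-13 datum, whose flow IS `genFlow (betaOfRecord₁₃ θ) g₀` — `x ∈ Survivors β γ K ⟺ (C ⟨K, m, x⟩).flow.InInterval γ K` (Gaps' `survivor_iff_run` +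
forward uniqueness `FlowStepRuns.flow_eq_of_rgEqH`); so every window clause is a NON-EMPTINESS clause for survivor sets (`Window (datum) ⟺ ∃ γ₁ > 0, ∀ γ ∈ ]0, γ₁], ∃ K ≥ 1, (Survivors β_θ γ K).Nonempty`),
and (§1) under ROW (i) ALONE (`RunConstRemainder β b r γ₀`, `b` any sequence) each `Survivors β γ K`, `γ ∈ ]0, γ₀]`, CONTAINS THE EXPLICIT INITIAL INTERVAL `]0, x_K(γ)]`,
`x_K(γ)⁻² = γ⁻² + Σ_{k<K} max(b_k + r, 0)` (rows (i)(ii): `γ⁻² + K·max(B + r, 0)`) — it is non-empty, infinite, and reaches down to `0⁺` (file 8's ladder read at `modelOf β` + Gaps'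
`survives_of_run`).  Consequently (§4) DEF-1's letter `RunRemAt F κ θ hP c` asks its (C) conjunct, at its own level `γ₀`, on sets each containing an initial interval: given the
remainder conjunct, `SurvCont` is NEVER a statement about empty or finite sets (A6 bookkeeping for K2⁷'s 2ᴮ″; the letter itself stays a displayed hypothesis).

WHAT THIS FILE PROVES (theorems only; 0 `def`, 0 `sorry`, standard axioms).
* §1 (any `β`): `mem_survivors_of_runwiseCeiling` · `Ioc_subset_survivors_of_runwiseCeiling` · ★ `Ioc_subset_survivors_of_runConstRemainder` · `survivors_nonempty_of_runConstRemainder` ·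
  `survivors_infinite_of_runConstRemainder` · `Ioc_subset_survivors_of_runConstRemainder_of_le`.
* §2 (canonical construction): ★ `mem_survivors_iff_inInterval_modelOf` · `exists_inInterval_modelOf_iff_survivors_nonempty` · `clampPrefix_eq_prefixOf_genSeq` ·
  ★ `survCont_iff_continuousOn_alongGenSeq` (DEF-1's (C) conjunct = continuity in the bare coupling of the β's read along the generated runs).
* §3 (NODE 00's Stage-13 datum, general `N`): ★★ `mem_survivors_betaOfRecord₁₃_iff_inInterval_datumOfRecord₁₃SepCoPH` · `window_datumOfRecord₁₃SepCoPH_iff_survivors_nonempty` ·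
  `Ioc_subset_survivors_betaOfRecord₁₃_of_runConstRemainder` · `survCont_betaOfRecord₁₃_iff_continuousOn_alongRuns`.
* §4 (DEF-1's letter, `N = 2`): ★ `survCont_on_initialIntervals_of_runRemAt`.
* §5 (v1.1, THE END from rows (i)+(iv) + (C)): `runwisePS_nonneg` · ★★ `endpointExistence_of_runConstRemainder_runwisePS_survCont` (any forward-generated `C`) ·
  ★★ `endpointExistence_datumOfRecord₁₃SepCoPH_of_runRows_survCont` (general `N`) · ★ `endpointExistence_datumOfRecord₁₃SepCoPH_of_runRowsAt_of_betaContH` (`N = 2`: v6's stub-2″ rows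
  ∃-text at `(θ, h, w)` + box continuity `BetaContH θ.γ β_θ` ⟹ K2⁷'s consequent `EndpointExistence (datum).C.toB12` — no drift, no anchor, no (B), no match) ·
  ★ `runRows_without_cont_not_endpointExistence` ((C) is LOAD-BEARING: Gaps' staircase `betaJ` carries all four rows and NO `EndpointExistence`) ·
  (v1.2) ★ `runRows_without_floor_not_endpointExistence` (row (iv) is LOAD-BEARING too: `β ≡ −1` carries (i)(ii)+(C) and NO `EndpointExistence`).

HONEST SCOPE (A6, №189).  Elementary set bookkeeping over the tree's carriers; row (i), DEF-1's letter and every β-side statement are DISPLAYED HYPOTHESES inhabited at NO θ here (NODE O's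
[I] Thm 3 p. 264 ∕ (5.10) p. 293; continuity in the coupling asserted in [I] §1 pp. 263–264 without located proof); nothing of Bałaban asserted; NOT a proof of `stub_runRows13PWS`,
`stub_nodes13PWS` or any K2⁷ stub; K1⁷ ∕ K2⁷ NOT closed; N13 NOT discharged; counts unmoved (typed 28∕28 · discharged 5∕27 · A 5∕28).  One finite four-torus programme at fixed `ε = L^{−K}`,
Bałaban AS PRINTED; the Yang–Mills mass gap (Clay) is NOT proved by any of this — route R4 closes the conditional finite-𝕋⁴ rung `BalabanLadder.UV` only; nothing continuum ∕ ℝ⁴ ∕ OS.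
No `def`, no `instance`, no `notation`, no `axiom`.
References (context only): [I] = [Balaban1987RG1] CMP **109** (1987): (0.17)–(0.20) pp. 255–256, Thm 2 p. 259, §1 pp. 263–264, Thm 3 p. 264, (5.10) p. 293; [V] = [Balaban1989LargeFieldII]
CMP **122** (1989): Thm 1 + (0.1) pp. 355–356.
-/

noncomputable section

open scoped Matrix.Norms.L2Operator

namespace Summit.QuantumFields.YangMills.Theorems.BalabanUVNodesK1WindowKOfRunRowsSurvivors

open Literature.MathematicalPhysics.QuantumFieldTheory.Balaban1983to89
open Literature.MathematicalPhysics.QuantumFieldTheory.Balaban1983to89.FlowStep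
open Literature.MathematicalPhysics.QuantumFieldTheory.Balaban1983to89.FlowStepRuns
open Literature.MathematicalPhysics.QuantumFieldTheory.Balaban1983to89.DagBinding
open Literature.MathematicalPhysics.QuantumFieldTheory.Balaban1983to89.T4Continuum (T4Family)
open Literature.MathematicalPhysics.QuantumFieldTheory.Balaban1983to89.Node00
open Summit.QuantumFields.YangMills.Theorems.BalabanUVNodesK2NamedJetsRunRemAt (RunRemAt RunConstRemainder Survivors SurvCont run_of_survivor)
open Summit.QuantumFields.YangMills.Theorems.BalabanUVNodesK2JsOfRecord (StepColourData beta0OfJs)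
open Summit.QuantumFields.BalabanUV.Gaps.EndRunwiseShooting (survives_of_run shoot_zero)
open Summit.QuantumFields.YangMills.Theorems.BalabanUVNodesK1WindowKOfRunRows

/-! ## §1. Under row (i) every survivor set contains an explicit initial interval -/

section Flow

variable {β : HBeta}

/-- **A SMALL BARE COUPLING SURVIVES** (run-wise per-level ceiling `u`, level `γ ∈ ]0, γ₀]`): every `x > 0` with `γ⁻² + Σ_{k<K} max(u_k,0) ≤ x⁻²` lies in `Survivors β γ K` — file 8's
ladder at the canonical construction `modelOf β` makes the run from `x` an in-window (0.20)-run, and runs are survivors (`Gaps.EndRunwiseShooting.survives_of_run`).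
[cite: Balaban1987RG1, (0.17)–(0.20) pp.255–256 and Thm 3 p.264 (elementary consequence)] -/
theorem mem_survivors_of_runwiseCeiling {u : ℕ → ℝ} {γ₀ γ x : ℝ}
    (hup : ∀ (n : ℕ) (gs : ℕ → ℝ), RGEqH n β gs → Step.InInterval γ₀ n gs → ∀ k, k ≤ n → β k (prefixOf gs k) ≤ u k)
    (hγ : 0 < γ) (hγ₀ : γ ≤ γ₀) (hx : 0 < x) (K : ℕ) (hstart : 1 / γ ^ 2 + ∑ k ∈ Finset.range K, max (u k) 0 ≤ 1 / x ^ 2) :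
    x ∈ Survivors β γ K := by
  obtain ⟨hrg, hb⟩ := ladder_of_forwardGenerated_of_runwiseCeiling (modelOf β) β (modelOf_forwardGenerated β) hup hγ hγ₀ hx 0 K hstart K le_rfl
  have e : ((modelOf β) ⟨K, 0, x⟩).flow.g 0 = x := (modelOf_forwardGenerated β).1 _
  have hI : Step.InInterval γ K ((modelOf β) ⟨K, 0, x⟩).flow.g := fun k hk => (hb k hk).1
  have hs := survives_of_run hrg hI
  have hxγ := (hb 0 (Nat.zero_le _)).1.2
  rw [e] at hs hxγ
  exact ⟨hx, hxγ, hs⟩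

/-- **THE INITIAL INTERVAL `]0, (γ⁻² + Σ_{k<K} max(u_k,0))^{−1∕2}]` LIES IN `Survivors β γ K`** (run-wise per-level ceiling; `γ ∈ ]0, γ₀]`). [cite: Balaban1987RG1, (0.17)–(0.20) pp.255–256 and Thm 3 p.264 (elementary consequence)] -/
theorem Ioc_subset_survivors_of_runwiseCeiling {u : ℕ → ℝ} {γ₀ γ : ℝ}
    (hup : ∀ (n : ℕ) (gs : ℕ → ℝ), RGEqH n β gs → Step.InInterval γ₀ n gs → ∀ k, k ≤ n → β k (prefixOf gs k) ≤ u k)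
    (hγ : 0 < γ) (hγ₀ : γ ≤ γ₀) (K : ℕ) :
    Set.Ioc 0 (1 / Real.sqrt (1 / γ ^ 2 + ∑ k ∈ Finset.range K, max (u k) 0)) ⊆ Survivors β γ K := by
  intro x hx
  have hS0 : 0 ≤ ∑ k ∈ Finset.range K, max (u k) 0 := Finset.sum_nonneg fun j _ => le_max_right _ _
  have hApos : 0 < 1 / γ ^ 2 + ∑ k ∈ Finset.range K, max (u k) 0 := add_pos_of_pos_of_nonneg (by positivity) hS0
  refine mem_survivors_of_runwiseCeiling hup hγ hγ₀ hx.1 K ?_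
  have h1 : Real.sqrt (1 / γ ^ 2 + ∑ k ∈ Finset.range K, max (u k) 0) ≤ 1 / x := by
    have h := one_div_le_one_div_of_le hx.1 hx.2
    rwa [one_div_one_div] at h
  have h2 := pow_le_pow_left₀ (Real.sqrt_nonneg _) h1 2
  rwa [Real.sq_sqrt hApos.le, one_div_pow] at h2

/-- ★ **K1⁷ v6's ROW (i) ALONE ⟹ EVERY SURVIVOR SET CONTAINS AN EXPLICIT INITIAL INTERVAL**: `RunConstRemainder β b r γ₀` (`b` any sequence) ⟹ for every `γ ∈ ]0, γ₀]` and every `K`,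
`]0, (γ⁻² + Σ_{k<K} max(b_k + r, 0))^{−1∕2}] ⊆ Survivors β γ K`.  DISPLAYED hypothesis (NODE O's). [cite: Balaban1987RG1, Thm 3 p.264, (1.20)–(1.22) p.264 and (5.10) p.293 (elementary consequence)] -/
theorem Ioc_subset_survivors_of_runConstRemainder {b : ℕ → ℝ} {r γ₀ : ℝ} (hrem : RunConstRemainder β b r γ₀) {γ : ℝ} (hγ : 0 < γ) (hγ₀ : γ ≤ γ₀) (K : ℕ) :
    Set.Ioc 0 (1 / Real.sqrt (1 / γ ^ 2 + ∑ k ∈ Finset.range K, max (b k + r) 0)) ⊆ Survivors β γ K :=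
  Ioc_subset_survivors_of_runwiseCeiling (runwiseCeiling_of_runConstRemainder hrem) hγ hγ₀ K

/-- … so every survivor set of a level `γ ∈ ]0, γ₀]` is NON-EMPTY … [cite: Balaban1987RG1, Thm 3 p.264 (elementary consequence)] -/
theorem survivors_nonempty_of_runConstRemainder {b : ℕ → ℝ} {r γ₀ : ℝ} (hrem : RunConstRemainder β b r γ₀) {γ : ℝ} (hγ : 0 < γ) (hγ₀ : γ ≤ γ₀) (K : ℕ) :
    (Survivors β γ K).Nonempty := by
  have hS0 : 0 ≤ ∑ k ∈ Finset.range K, max (b k + r) 0 := Finset.sum_nonneg fun j _ => le_max_right _ _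
  have hpos : 0 < 1 / Real.sqrt (1 / γ ^ 2 + ∑ k ∈ Finset.range K, max (b k + r) 0) :=
    div_pos one_pos (Real.sqrt_pos.mpr (add_pos_of_pos_of_nonneg (by positivity) hS0))
  exact ⟨_, Ioc_subset_survivors_of_runConstRemainder hrem hγ hγ₀ K ⟨hpos, le_rfl⟩⟩

/-- … and INFINITE (it contains a non-degenerate interval). [cite: Balaban1987RG1, Thm 3 p.264 (elementary consequence)] -/
theorem survivors_infinite_of_runConstRemainder {b : ℕ → ℝ} {r γ₀ : ℝ} (hrem : RunConstRemainder β b r γ₀) {γ : ℝ} (hγ : 0 < γ) (hγ₀ : γ ≤ γ₀) (K : ℕ) :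
    (Survivors β γ K).Infinite := by
  have hS0 : 0 ≤ ∑ k ∈ Finset.range K, max (b k + r) 0 := Finset.sum_nonneg fun j _ => le_max_right _ _
  have hpos : (0 : ℝ) < 1 / Real.sqrt (1 / γ ^ 2 + ∑ k ∈ Finset.range K, max (b k + r) 0) :=
    div_pos one_pos (Real.sqrt_pos.mpr (add_pos_of_pos_of_nonneg (by positivity) hS0))
  exact (Set.Ioc_infinite hpos).mono (Ioc_subset_survivors_of_runConstRemainder hrem hγ hγ₀ K)

/-- **ROWS (i)(ii): the K-linear interval `]0, (γ⁻² + K·max(B + r, 0))^{−1∕2}] ⊆ Survivors β γ K`.** [cite: Balaban1987RG1, Thm 3 p.264 and (1.20)–(1.22) p.264 (elementary consequence)] -/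
theorem Ioc_subset_survivors_of_runConstRemainder_of_le {b : ℕ → ℝ} {r γ₀ B : ℝ} (hrem : RunConstRemainder β b r γ₀) (hB : ∀ k, b k ≤ B)
    {γ : ℝ} (hγ : 0 < γ) (hγ₀ : γ ≤ γ₀) (K : ℕ) :
    Set.Ioc 0 (1 / Real.sqrt (1 / γ ^ 2 + (K : ℝ) * max (B + r) 0)) ⊆ Survivors β γ K := by
  intro x hx
  have hS0 : 0 ≤ ∑ k ∈ Finset.range K, max (b k + r) 0 := Finset.sum_nonneg fun j _ => le_max_right _ _
  have hApos : 0 < 1 / γ ^ 2 + ∑ k ∈ Finset.range K, max (b k + r) 0 := add_pos_of_pos_of_nonneg (by positivity) hS0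
  have hle : ∑ k ∈ Finset.range K, max (b k + r) 0 ≤ (K : ℝ) * max (B + r) 0 := by
    have h := Finset.sum_le_card_nsmul (Finset.range K) (fun k => max (b k + r) 0) (max (B + r) 0)
      fun k _ => max_le_max (by linarith [hB k]) le_rfl
    rwa [Finset.card_range, nsmul_eq_mul] at h
  refine Ioc_subset_survivors_of_runConstRemainder hrem hγ hγ₀ K ⟨hx.1, hx.2.trans ?_⟩
  exact one_div_le_one_div_of_le (Real.sqrt_pos.mpr hApos) (Real.sqrt_le_sqrt (by linarith))

end Flow

/-! ## §2. At the canonical construction `modelOf β`: survivors = the bare couplings whose run of length `K` stays in the window -/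

section Model

variable (β : HBeta)

/-- ★ **SURVIVORS ARE EXACTLY THE WINDOW's BARE COUPLINGS** (canonical construction `modelOf β`, level `γ > 0`, any torus exponent `m`): `x ∈ Survivors β γ K` iff the run `⟨K, m, x⟩` of
`modelOf β` (couplings `genSeq β x`) stays in `]0, γ]` up to `K`.  (→) survivors are runs (DEF-1's `run_of_survivor`) and forward uniqueness (`FlowStepRuns.flow_eq_of_rgEqH`) identifies the
clamped shooting run with `genSeq β x`; (←) in-window runs of the forward-generated, halting, currying `modelOf β` solve (0.20) (`FlowStepRuns.satisfiesRG_of_inInterval`, `rgEqH_of_curries`)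
and runs are survivors (`survives_of_run`). [cite: Balaban1987RG1, (0.17)–(0.20) pp.255–256 (bookkeeping + elementary)] -/
theorem mem_survivors_iff_inInterval_modelOf {γ : ℝ} (hγ : 0 < γ) (K m : ℕ) (x : ℝ) :
    x ∈ Survivors β γ K ↔ ((modelOf β) ⟨K, m, x⟩).flow.InInterval γ K := by
  constructor
  · intro hx
    obtain ⟨hrg, hI⟩ := run_of_survivor (β := β) hγ hx
    have h0 : ((modelOf β) ⟨K, m, x⟩).flow.g 0 = (fun i => gClamp γ (Y β γ i x)) 0 := by
      rw [(modelOf_forwardGenerated β).1]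
      exact (shoot_zero hx.1 hx.2.1).symm
    have hagree := flow_eq_of_rgEqH ((modelOf β) ⟨K, m, x⟩).flow β K (fun k hk => (modelOf_forwardGenerated β).2 ⟨K, m, x⟩ k hk) h0 hrg
      (fun k hk => (hI k hk).1)
    intro k hk
    rw [hagree k hk]
    exact hI k hk
  · intro hI
    have hsat := satisfiesRG_of_inInterval (modelOf_forwardGenerated β) (modelOf_haltsOutside β) (modelOf_curries β) ⟨K, m, x⟩ hI
    have hrg : RGEqH K β ((modelOf β) ⟨K, m, x⟩).flow.g := rgEqH_of_curries (modelOf β) β (modelOf_curries β) ⟨K, m, x⟩ hsat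
    have hs := survives_of_run hrg hI
    have hx := hI 0 (Nat.zero_le _)
    have e : ((modelOf β) ⟨K, m, x⟩).flow.g 0 = x := (modelOf_forwardGenerated β).1 _
    rw [e] at hs hx
    exact ⟨hx.1, hx.2, hs⟩

/-- **THE K-INDEXED WINDOW CLAUSE IS SURVIVOR NON-EMPTINESS** (canonical construction): `(∃ g₀ > 0, (modelOf β ⟨K, m, g₀⟩).flow.InInterval γ K) ⟺ (Survivors β γ K).Nonempty`.
[cite: Balaban1987RG1, (0.17)–(0.20) pp.255–256 and Thm 2 p.259 (bookkeeping)] -/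
theorem exists_inInterval_modelOf_iff_survivors_nonempty {γ : ℝ} (hγ : 0 < γ) (K m : ℕ) :
    (∃ g0 : ℝ, 0 < g0 ∧ ((modelOf β) ⟨K, m, g0⟩).flow.InInterval γ K) ↔ (Survivors β γ K).Nonempty := by
  constructor
  · rintro ⟨g0, -, hI⟩
    exact ⟨g0, (mem_survivors_iff_inInterval_modelOf β hγ K m g0).2 hI⟩
  · rintro ⟨x, hx⟩
    exact ⟨x, hx.1, (mem_survivors_iff_inInterval_modelOf β hγ K m x).1 hx⟩

/-- **A SURVIVOR's CLAMPED PREFIX IS THE GENERATED RUN's PREFIX**: for `x ∈ Survivors β γ K` and `k ≤ K`, `clampPrefix β γ k x = (genSeq β x)_0..k` — the clamp never acts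
(DEF-1's `run_of_survivor` + forward uniqueness `FlowStepRuns.flow_eq_of_rgEqH` at `modelOf β`).  So the «traces» of DEF-1's `SurvCont` are the β's READ ALONG THE GENERATED RUNS, as
functions of the bare coupling. [cite: Balaban1987RG1, (0.17)–(0.20) pp.255–256 (bookkeeping)] -/
theorem clampPrefix_eq_prefixOf_genSeq {γ : ℝ} (hγ : 0 < γ) {K : ℕ} {x : ℝ} (hx : x ∈ Survivors β γ K) :
    ∀ k, k ≤ K → clampPrefix β γ k x = prefixOf (genSeq β x) k := by
  obtain ⟨hrg, hI⟩ := run_of_survivor (β := β) hγ hx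
  have h0 : ((modelOf β) ⟨K, 0, x⟩).flow.g 0 = (fun i => gClamp γ (Y β γ i x)) 0 := by
    rw [(modelOf_forwardGenerated β).1]
    exact (shoot_zero hx.1 hx.2.1).symm
  have hagree := flow_eq_of_rgEqH ((modelOf β) ⟨K, 0, x⟩).flow β K (fun k hk => (modelOf_forwardGenerated β).2 ⟨K, 0, x⟩ k hk) h0 hrg
    (fun k hk => (hI k hk).1)
  intro k hk
  funext j
  have hj : (j : ℕ) ≤ K := (Nat.lt_succ_iff.mp j.isLt).trans hk
  show gClamp γ (Y β γ j x) = ((modelOf β) ⟨K, 0, x⟩).flow.g j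
  exact (hagree j hj).symm

/-- ★ **DEF-1's (C) CONJUNCT IN RUN TERMS**: `SurvCont β γ` (continuity of the clamped traces on the survivor sets) IS, level by level, continuity IN THE BARE COUPLING of
`x ↦ β k ((genSeq β x)_0..k)` — the `k`-th β-function read along the run generated from `x` — on the set of bare couplings whose run survives `k` steps in `]0, γ]`.
[cite: Balaban1987RG1, §1 pp.263–264 and (0.17)–(0.20) pp.255–256 (bookkeeping)] -/
theorem survCont_iff_continuousOn_alongGenSeq {γ : ℝ} (hγ : 0 < γ) :
    SurvCont β γ ↔ ∀ k : ℕ, ContinuousOn (fun x : ℝ => β k (prefixOf (genSeq β x) k)) (Survivors β γ k) :=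
  forall_congr' fun k => continuousOn_congr fun _ hx => congrArg (β k) (clampPrefix_eq_prefixOf_genSeq β hγ hx k le_rfl)

end Model

/-! ## §3. At NODE 00's Stage-13 datum (general `N`): the datum's flow IS `genFlow (betaOfRecord₁₃ θ) g₀`, so its window clauses are survivor non-emptiness clauses -/

section Record

variable {F : T4Family} {N : ℕ} [NeZero N]

/-- ★★ **AT THE STAGE-13 DATUM, THE SURVIVOR SET OF `betaOfRecord₁₃ θ` AT LEVEL `γ > 0` IS THE SET OF BARE COUPLINGS WHOSE RUN OF LENGTH `K` STAYS IN `]0, γ]`** (every proviso witness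
`h`, every `m`): the datum's construction has the flow of `modelOf (betaOfRecord₁₃ θ)` (def-T: `gOfRecord₁₃ θ ⟨K, m, g₀⟩ = genSeq β_θ g₀`, definitional), so §2 applies verbatim.
[cite: Balaban1987RG1, (0.17)–(0.20) pp.255–256 and (1.20)–(1.22) p.264; Balaban1989LargeFieldII, Thm 1 + (0.1) pp.355–356 (bookkeeping)] -/
theorem mem_survivors_betaOfRecord₁₃_iff_inInterval_datumOfRecord₁₃SepCoPH (θ : Stage13HParams F N) (h : θ.Provisos₁₃SepCoPH F N) {γ : ℝ} (hγ : 0 < γ)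
    (K m : ℕ) (x : ℝ) :
    x ∈ Survivors (betaOfRecord₁₃ F N θ.toStage13Params) γ K ↔ ((datumOfRecord₁₃SepCoPH F N θ h).C ⟨K, m, x⟩).flow.InInterval γ K :=
  mem_survivors_iff_inInterval_modelOf (betaOfRecord₁₃ F N θ.toStage13Params) hγ K m x

/-- **K1⁷'s WINDOW CONJUNCT AT THE DATUM ⟺ SURVIVOR NON-EMPTINESS** (text of the crux's last conjunct on the left; every `h`): `(∃ γ₁ > 0, ∀ γ ∈ ]0, γ₁], ∃ P, 1 ≤ P.K ∧ run P in ]0, γ])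
⟺ (∃ γ₁ > 0, ∀ γ ∈ ]0, γ₁], ∃ K ≥ 1, (Survivors (betaOfRecord₁₃ θ) γ K).Nonempty)`.  The crux's non-vacuity clause, in DEF-1's ∕ Gaps' set language.
[cite: Balaban1987RG1, (0.17)–(0.20) pp.255–256; Balaban1989LargeFieldII, Thm 1 + (0.1) pp.355–356 (bookkeeping)] -/
theorem window_datumOfRecord₁₃SepCoPH_iff_survivors_nonempty (θ : Stage13HParams F N) (h : θ.Provisos₁₃SepCoPH F N) :
    (∃ γ₁ : ℝ, 0 < γ₁ ∧ ∀ γ : ℝ, 0 < γ → γ ≤ γ₁ →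
        ∃ P : B12.RunParams, 1 ≤ P.K ∧ ((datumOfRecord₁₃SepCoPH F N θ h).C P).flow.InInterval γ P.K) ↔
      ∃ γ₁ : ℝ, 0 < γ₁ ∧ ∀ γ : ℝ, 0 < γ → γ ≤ γ₁ → ∃ K : ℕ, 1 ≤ K ∧ (Survivors (betaOfRecord₁₃ F N θ.toStage13Params) γ K).Nonempty := by
  constructor
  · rintro ⟨γ₁, hγ₁, H⟩
    refine ⟨γ₁, hγ₁, fun γ hγ hγle => ?_⟩
    obtain ⟨P, hP, hI⟩ := H γ hγ hγle
    exact ⟨P.K, hP, P.g0, (mem_survivors_betaOfRecord₁₃_iff_inInterval_datumOfRecord₁₃SepCoPH θ h hγ P.K P.m P.g0).2 hI⟩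
  · rintro ⟨γ₁, hγ₁, H⟩
    refine ⟨γ₁, hγ₁, fun γ hγ hγle => ?_⟩
    obtain ⟨K, hK, x, hx⟩ := H γ hγ hγle
    exact ⟨⟨K, 0, x⟩, hK, (mem_survivors_betaOfRecord₁₃_iff_inInterval_datumOfRecord₁₃SepCoPH θ h hγ K 0 x).1 hx⟩

/-- **AT THE DATUM, ROW (i) ALONE ⟹ EVERY SURVIVOR SET OF `betaOfRecord₁₃ θ` CONTAINS AN EXPLICIT INITIAL INTERVAL** (hence, by the dictionary above, the bare couplings
`g₀ ∈ ]0, (γ⁻² + Σ_{k<K} max(b_k + r, 0))^{−1∕2}]` ALL run `⟨K, m, g₀⟩` inside `]0, γ]`).  DISPLAYED hypothesis; NOT a proof of `stub_runRows13PWS`.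
[cite: Balaban1987RG1, Thm 3 p.264, (1.20)–(1.22) p.264, (5.10) p.293; Balaban1989LargeFieldII, Thm 1 p.355 (bookkeeping + elementary)] -/
theorem Ioc_subset_survivors_betaOfRecord₁₃_of_runConstRemainder (θ : Stage13HParams F N) {b : ℕ → ℝ} {r γ₀ : ℝ}
    (hrem : RunConstRemainder (betaOfRecord₁₃ F N θ.toStage13Params) b r γ₀) {γ : ℝ} (hγ : 0 < γ) (hγ₀ : γ ≤ γ₀) (K : ℕ) :
    Set.Ioc 0 (1 / Real.sqrt (1 / γ ^ 2 + ∑ k ∈ Finset.range K, max (b k + r) 0)) ⊆ Survivors (betaOfRecord₁₃ F N θ.toStage13Params) γ K :=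
  Ioc_subset_survivors_of_runConstRemainder hrem hγ hγ₀ K

/-- **AT THE DATUM, K2⁷'s (C) CONJUNCT READS: continuity in the bare coupling `g₀` of `β_θ k (g_0(g₀),…,g_k(g₀))` along the datum's own run `⟨k, m, g₀⟩`, on the set of bare couplings
whose run of length `k` stays in `]0, γ]`** (every `h`, `m`; the datum's couplings are `genSeq β_θ g₀`).  A reading aid for `RunRemAt`'s `SurvCont` at NODE 00's record; nothing asserted.
[cite: Balaban1987RG1, §1 pp.263–264, (1.20)–(1.22) p.264; Balaban1989LargeFieldII, Thm 1 p.355 (bookkeeping)] -/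
theorem survCont_betaOfRecord₁₃_iff_continuousOn_alongRuns (θ : Stage13HParams F N) (h : θ.Provisos₁₃SepCoPH F N) {γ : ℝ} (hγ : 0 < γ) (m : ℕ) :
    SurvCont (betaOfRecord₁₃ F N θ.toStage13Params) γ ↔
      ∀ k : ℕ, ContinuousOn
        (fun g₀ : ℝ => betaOfRecord₁₃ F N θ.toStage13Params k (prefixOf ((datumOfRecord₁₃SepCoPH F N θ h).C ⟨k, m, g₀⟩).flow.g k))
        {g₀ : ℝ | ((datumOfRecord₁₃SepCoPH F N θ h).C ⟨k, m, g₀⟩).flow.InInterval γ k} := by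
  rw [survCont_iff_continuousOn_alongGenSeq _ hγ]
  refine forall_congr' fun k => ?_
  have hS : Survivors (betaOfRecord₁₃ F N θ.toStage13Params) γ k = {g₀ : ℝ | ((datumOfRecord₁₃SepCoPH F N θ h).C ⟨k, m, g₀⟩).flow.InInterval γ k} :=
    Set.ext fun x => mem_survivors_betaOfRecord₁₃_iff_inInterval_datumOfRecord₁₃SepCoPH θ h hγ k m x
  rw [← hS]
  exact Iff.rfl

end Record

/-! ## §4. DEF-1's run letter asks its (C) conjunct on non-trivial sets at every level -/

section Letter

variable {F : T4Family}

/-- ★ **THE `SurvCont` CONJUNCT OF `RunRemAt F κ θ hP c` IS NEVER ASKED ON A TRIVIAL DOMAIN**: the letter (DEF-1, VERBATIM) yields a level `γ₀ ∈ ]0, θ.γ]` carrying BOTH its survivor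
continuity `SurvCont β_θ γ₀` AND, from its own remainder conjunct (reference sequence `c·beta0OfJs F κ`, remainder `s`), the initial intervals
`]0, (γ₀⁻² + Σ_{j<k} max(c·b_j + s, 0))^{−1∕2}] ⊆ Survivors β_θ γ₀ k` at EVERY `k` — so each `ContinuousOn` clause of (C) speaks about an infinite set reaching `0⁺`.  A6 bookkeeping for K2⁷'s
2ᴮ″ letter; the letter is a HYPOTHESIS (K2⁷ NOT closed; (P6) unpinned). [cite: Balaban1987RG1, §1 pp.263–264, Thm 3 p.264, (2.12)–(2.14) p.268 and (5.10) p.293 (bookkeeping + elementary)] -/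
theorem survCont_on_initialIntervals_of_runRemAt (κ : StepColourData) (θ : Stage13HParams F 2) (hP : θ.Provisos₁₃SepCoPH F 2) {c : ℝ} (hRun : RunRemAt F κ θ hP c) :
    ∃ γ₀ s : ℝ, 0 < γ₀ ∧ γ₀ ≤ θ.γ ∧ SurvCont (datumOfRecord₁₃SepCoPH F 2 θ hP).βfun γ₀ ∧
      ∀ k : ℕ, Set.Ioc 0 (1 / Real.sqrt (1 / γ₀ ^ 2 + ∑ j ∈ Finset.range k, max (c * beta0OfJs F κ j + s) 0)) ⊆
        Survivors (datumOfRecord₁₃SepCoPH F 2 θ hP).βfun γ₀ k := by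
  obtain ⟨γ₀, s, hγ₀, hγθ, -, hrem, -, hsc⟩ := hRun
  exact ⟨γ₀, s, hγ₀, hγθ, hsc, fun k => Ioc_subset_survivors_of_runConstRemainder hrem hγ₀ le_rfl k⟩

end Letter

/-! ## §5. (v1.1) Rows (i)+(iv) together with DEF-1's (C) give THE END: K2⁷'s consequent `EndpointExistence` at a K1⁷ rows-witness costs survivor continuity only

v1.1 (same seat, 2026-08-28; append-only: §§1–4 byte-identical).  THE POINT.  DEF-1's `endpointExistence_of_drift_runConstRemainder_survCont` (p596574 §1) reaches the END from the run
letter by MANUFACTURING the run-wise (PS) out of the (D1) drift and the cap `r ≤ s`.  K1⁷ v6's stub 2″ carries the run-wise (PS) floor as its OWN row (iv); so at any `(θ, h)` where rows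
(i) `RunConstRemainder β_θ b r γ₀` and (iv) hold, the Gaps survivor-letters road `EndSurvivorCensus.endpointExistence_of_survivorLetters_runwisePS_locUpper` (per-level survivor bounds
`b_k + r` by DEF-1's `survUpper_of_runConstRemainder`; `0 ≤ M` from row (iv) at the one-point run) needs ONE more letter — (C) `SurvCont β_θ γ₀` — and NO drift, NO anchor, NO cap, NO (B),
NO ceiling match.  With K2⁷ LINE 2's S3-shape box continuity `BetaContH θ.γ β_θ` in place of (C), the v6 rows ∃-TEXT at `(θ, h, w)` suffices VERBATIM (`N = 2`; levels reconciled by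
`RunConstRemainder.mono`, n24-w1's `runwisePS_mono`, DEF-1's `SurvCont.of_betaContH`).  A BRIDGE between the two cruxes' currencies at a common witness; every letter stays a hypothesis. -/

section End

open Summit.QuantumFields.BalabanUV.Gaps.EndSurvivorCensus (endpointExistence_of_survivorLetters_runwisePS_locUpper)
open Summit.QuantumFields.YangMills.Theorems.BalabanUVNodesK2NamedJetsRunRemAt (survUpper_of_runConstRemainder)
open Summit.QuantumFields.YangMills.BalabanUVNodes.K1RunRowsOfBoxAndPartialSums (runwisePS_mono)

variable {β : HBeta}

/-- **ROW (iv) FORCES `0 ≤ M`**: the run-wise partial-sum floor read at the one-point run `(γ₀)` (an (0.20)-run up to `0`; empty window sum). [cite: Balaban1987RG1, Thm 2 p.259 (first sentence) (bookkeeping)] -/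
theorem runwisePS_nonneg {γ₀ M : ℝ} (hγ₀ : 0 < γ₀)
    (hps : ∀ (n : ℕ) (gs : ℕ → ℝ), RGEqH n β gs → Step.InInterval γ₀ n gs → ∀ k, k ≤ n → -M ≤ ∑ j ∈ Finset.Ico k n, β j (prefixOf gs j)) :
    0 ≤ M := by
  have hRG : RGEqH 0 β (fun _ => γ₀) := fun k hk => absurd hk (Nat.not_lt_zero k)
  have hI : Step.InInterval γ₀ 0 (fun _ => γ₀) := fun _ _ => ⟨hγ₀, le_rfl⟩
  have h0 := hps 0 (fun _ => γ₀) hRG hI 0 le_rfl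
  simp only [Finset.Ico_self, Finset.sum_empty] at h0
  linarith

/-- ★★ **ROWS (i)+(iv) + (C) ⟹ THE END** (any forward-generated `C`): DEF-1's run-wise constant remainder `RunConstRemainder β b r γ₀` (row (i); `b` any sequence, no `b ≤ B` needed), the
run-wise partial-sum floor `−M` along the in-window (0.20)-runs of level `γ₀` (row (iv)), and survivor continuity `SurvCont β γ₀` (DEF-1's (C) conjunct) give `DagBinding.EndpointExistence C`
— the endpoint-existence half of [I] Thm 2 as typed.  Road: Gaps' `endpointExistence_of_survivorLetters_runwisePS_locUpper` BY NAME with the per-level survivor bounds `b_k + r`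
(`survUpper_of_runConstRemainder`) and `0 ≤ M` (`runwisePS_nonneg`).  CONDITIONAL on three displayed letters; nothing of Bałaban asserted.
[cite: Balaban1987RG1, Thm 2 p.259 (first sentence), Thm 3 p.264, (1.20)–(1.22) p.264, §1 pp.263–264 and (5.10) p.293; Balaban1988RG2Cluster, (2.41) p.21 (bookkeeping)] -/
theorem endpointExistence_of_runConstRemainder_runwisePS_survCont {C : B12.Construction} (hgen : ForwardGenerated C β) {b : ℕ → ℝ} {r γ₀ M : ℝ}
    (hγ₀ : 0 < γ₀) (hrem : RunConstRemainder β b r γ₀)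
    (hps : ∀ (n : ℕ) (gs : ℕ → ℝ), RGEqH n β gs → Step.InInterval γ₀ n gs → ∀ k, k ≤ n → -M ≤ ∑ j ∈ Finset.Ico k n, β j (prefixOf gs j))
    (hsc : SurvCont β γ₀) : EndpointExistence C :=
  endpointExistence_of_survivorLetters_runwisePS_locUpper hgen hγ₀ (runwisePS_nonneg hγ₀ hps) hsc
    (fun k => ⟨b k + r, fun x hx0 hxγ hsurv => survUpper_of_runConstRemainder hγ₀ hrem k x hx0 hxγ hsurv⟩) hps

variable {F : T4Family} {N : ℕ} [NeZero N] in
/-- ★★ **AT THE STAGE-13 DATUM (general `N`): K1⁷ v6's ROWS (i)+(iv) FOR `betaOfRecord₁₃ θ` + (C) AT THE SAME LEVEL ⟹ K2⁷'s CONSEQUENT `EndpointExistence (datumOfRecord₁₃SepCoPH F N θ h).C.toB12`**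
(the datum is forward-generated by its own β of record: `(datum).fwd`, `(datum).βfun = betaOfRecord₁₃ θ` by def-T's `rfl`).  NO drift, NO anchor, NO cap, NO (B), NO ceiling match are read.
CONDITIONAL; K1⁷ ∕ K2⁷ NOT closed. [cite: Balaban1987RG1, Thm 2 p.259 (first sentence), Thm 3 p.264, (5.10) p.293, §1 pp.263–264; Balaban1989LargeFieldII, Thm 1 p.355 (bookkeeping)] -/
theorem endpointExistence_datumOfRecord₁₃SepCoPH_of_runRows_survCont (θ : Stage13HParams F N) (h : θ.Provisos₁₃SepCoPH F N) {b : ℕ → ℝ} {r γ₀ M : ℝ} (hγ₀ : 0 < γ₀)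
    (hrem : RunConstRemainder (betaOfRecord₁₃ F N θ.toStage13Params) b r γ₀)
    (hps : ∀ (n : ℕ) (gs : ℕ → ℝ), RGEqH n (betaOfRecord₁₃ F N θ.toStage13Params) gs → Step.InInterval γ₀ n gs →
      ∀ k, k ≤ n → -M ≤ ∑ j ∈ Finset.Ico k n, betaOfRecord₁₃ F N θ.toStage13Params j (prefixOf gs j))
    (hsc : SurvCont (betaOfRecord₁₃ F N θ.toStage13Params) γ₀) :
    EndpointExistence (datumOfRecord₁₃SepCoPH F N θ h).C.toB12 :=
  endpointExistence_of_runConstRemainder_runwisePS_survCont (datumOfRecord₁₃SepCoPH F N θ h).fwd hγ₀ hrem hps hsc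

variable {F : T4Family} in
/-- ★ **`N = 2`: K1⁷ v6's STUB-2″ ROWS ∃-TEXT AT `(θ, h, w)` VERBATIM + BOX CONTINUITY ON `]0, θ.γ]` (K2⁷ LINE 2's S3 shape `BetaContH θ.γ β_θ`) + `0 < θ.γ` ⟹ K2⁷'s CONSEQUENT AT θ.**  Only rows
(i) and (iv) are read ((ii) `b ≤ B` and (iii) the match are the END road's price for (B), not for the endpoint); the rows' level `γ₀` is cut to `γ₁ := min γ₀ θ.γ` (`RunConstRemainder.mono`,
`runwisePS_mono`), where box continuity restricts and yields (C) (`SurvCont.of_betaContH`).  So at a witness of K1⁷'s stub 2″, K2⁷'s endpoint costs S3 alone — no S2 anchor, no (D1) drift.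
CONDITIONAL on the displayed letters; NOT a proof of any registered stub; K1⁷ ∕ K2⁷ NOT closed. [cite: Balaban1987RG1, Thm 2 p.259 (first sentence), Thm 3 p.264, (5.10) p.293, §1 pp.263–264; Balaban1988RG2Cluster, (2.41) p.21; Balaban1989LargeFieldII, Thm 1 p.355 (bookkeeping)] -/
theorem endpointExistence_datumOfRecord₁₃SepCoPH_of_runRowsAt_of_betaContH (θ : Stage13HParams F 2) (h : θ.Provisos₁₃SepCoPH F 2) (w : WorldP) (hγθ : 0 < θ.γ)
    (hrows : ∃ (b : ℕ → ℝ) (r γ₀ B M : ℝ), 0 < γ₀ ∧ RunConstRemainder (betaOfRecord₁₃ F 2 θ.toStage13Params) b r γ₀ ∧ (∀ k, b k ≤ B) ∧ B + r ≤ w.βup ∧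
      ∀ (n : ℕ) (gs : ℕ → ℝ), RGEqH n (betaOfRecord₁₃ F 2 θ.toStage13Params) gs → Step.InInterval γ₀ n gs →
        ∀ k, k ≤ n → -M ≤ ∑ j ∈ Finset.Ico k n, betaOfRecord₁₃ F 2 θ.toStage13Params j (prefixOf gs j))
    (hcont : BetaContH θ.γ (betaOfRecord₁₃ F 2 θ.toStage13Params)) :
    EndpointExistence (datumOfRecord₁₃SepCoPH F 2 θ h).C.toB12 := by
  obtain ⟨b, r, γ₀, B, M, hγ₀, hrem, -, -, hps⟩ := hrows
  have hγ₁ : 0 < min γ₀ θ.γ := lt_min hγ₀ hγθ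
  have hcont₁ : BetaContH (min γ₀ θ.γ) (betaOfRecord₁₃ F 2 θ.toStage13Params) := fun k => (hcont k).mono (box_mono (min_le_right _ _) k)
  exact endpointExistence_datumOfRecord₁₃SepCoPH_of_runRows_survCont θ h hγ₁ (hrem.mono (min_le_left _ _)) (runwisePS_mono (min_le_left _ _) hps)
    (SurvCont.of_betaContH hγ₁ hcont₁)

open Summit.QuantumFields.BalabanUV.Gaps.EndContLetterWitness (betaJ betaLowerH_betaJ betaUpperH_betaJ not_endpointExistence_betaJ) in
open Summit.QuantumFields.YangMills.BalabanUVNodes.K1RunRowsOfBoxAndPartialSums (runConstRemainder_of_boxBounds runwisePS_of_betaLowerH_nonneg) in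
/-- ★ **(C) IS LOAD-BEARING: K1⁷ v6's FOUR RUN ROWS WITHOUT CONTINUITY DO NOT GIVE THE END.**  Kernel witness = Gaps' floor-staircase family `betaJ` (`Gaps/EndContLetterWitness`, g1-plan-2
N-15): `0 ≤ betaJ ≤ 1` on every box, so at level `γ₀ := 1` rows (i) `RunConstRemainder betaJ (k ↦ 1∕2) (1∕2) 1` (n24-w1's `runConstRemainder_of_boxBounds`), (ii) `b_k ≤ 1∕2`, (iv) the run-wise
floor with `M := 0` (`runwisePS_of_betaLowerH_nonneg`) all hold — and (iii) is met by any world with `w.βup ≥ 1` — yet `modelOf betaJ` has NO `EndpointExistence` (`not_endpointExistence_betaJ`).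
So at a witness of K1⁷'s stub 2″ the β-side difference between K1⁷ and K2⁷'s consequent is EXACTLY the continuity letter of §5. [folklore] -/
theorem runRows_without_cont_not_endpointExistence :
    ∃ (β : HBeta) (b : ℕ → ℝ) (r γ₀ B M : ℝ), 0 < γ₀ ∧ RunConstRemainder β b r γ₀ ∧ (∀ k, b k ≤ B) ∧
      (∀ (n : ℕ) (gs : ℕ → ℝ), RGEqH n β gs → Step.InInterval γ₀ n gs → ∀ k, k ≤ n → -M ≤ ∑ j ∈ Finset.Ico k n, β j (prefixOf gs j)) ∧
      ¬ EndpointExistence (modelOf β) :=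
  ⟨betaJ, fun _ => (0 + 1) / 2, (1 - 0) / 2, 1, (0 + 1) / 2, 0, one_pos, runConstRemainder_of_boxBounds (betaLowerH_betaJ 1) (betaUpperH_betaJ 1), fun _ => le_rfl,
    runwisePS_of_betaLowerH_nonneg le_rfl (betaLowerH_betaJ 1), not_endpointExistence_betaJ⟩

/-- (v1.2) Along the run generated by the CONSTANT family `β ≡ −1` every step ADDS one to `g⁻²`: `g₀⁻² + n ≤ g_n⁻²` (in fact `=`; the right side of (0.20) is `g_k⁻² + 1 > 0`, so the
generator never halts). [cite: Balaban1987RG1, (0.18)–(0.20) pp.255–256 (elementary)] -/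
private theorem inv_sq_genSeq_negOne (g0 : ℝ) : ∀ n : ℕ, 1 / g0 ^ 2 + n ≤ 1 / (genSeq (fun _ _ => (-1 : ℝ)) g0 n) ^ 2
  | 0 => by simp [genSeq_zero]
  | n + 1 => by
    have harg : 0 < 1 / (genSeq (fun _ _ => (-1 : ℝ)) g0 n) ^ 2 - (-1 : ℝ) := by rw [sub_neg_eq_add]; positivity
    have hs : 1 / (genSeq (fun _ _ => (-1 : ℝ)) g0 (n + 1)) ^ 2 = 1 / (genSeq (fun _ _ => (-1 : ℝ)) g0 n) ^ 2 - (-1 : ℝ) := by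
      rw [genSeq_succ]; exact inv_sq_solveCoupling harg
    have ih := inv_sq_genSeq_negOne g0 n
    push_cast; linarith

/-- ★ **(v1.2) ROW (iv) IS LOAD-BEARING TOO: rows (i)+(ii) + (C) WITHOUT the partial-sum floor do NOT give the END.**  Kernel witness = the constant family `β ≡ −1` (every letter except (iv):
`RunConstRemainder β (k ↦ −1) 0 γ₀`, `b ≤ −1`, constant traces hence `SurvCont`; but along its runs `g_K⁻² ≥ g₀⁻² + K`, so no target `g⋆` is reached at depth `K > g⋆⁻²`).  With
`runRows_without_cont_not_endpointExistence`: in §5's bridge NEITHER added letter — (iv) nor (C) — can be dropped. [folklore] -/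
theorem runRows_without_floor_not_endpointExistence :
    ∃ (β : HBeta) (b : ℕ → ℝ) (r γ₀ B : ℝ), 0 < γ₀ ∧ RunConstRemainder β b r γ₀ ∧ (∀ k, b k ≤ B) ∧ SurvCont β γ₀ ∧ ¬ EndpointExistence (modelOf β) := by
  refine ⟨fun _ _ => -1, fun _ => -1, 0, 1, -1, one_pos, fun n gs _ _ k _ => by simp, fun _ => le_rfl, fun k => continuousOn_const, fun hE => ?_⟩
  obtain ⟨γ₂, hγ₂, h⟩ := hE 0
  obtain ⟨gstar, hg, h⟩ := h γ₂ hγ₂ le_rfl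
  obtain ⟨g0, -, hend⟩ := h gstar hg le_rfl (⌈1 / gstar ^ 2⌉₊ + 1)
  have hle := inv_sq_genSeq_negOne g0 (⌈1 / gstar ^ 2⌉₊ + 1)
  have hend' : genSeq (fun _ _ => (-1 : ℝ)) g0 (⌈1 / gstar ^ 2⌉₊ + 1) = gstar := hend
  rw [hend'] at hle
  have hceil : 1 / gstar ^ 2 ≤ (⌈1 / gstar ^ 2⌉₊ : ℝ) := Nat.le_ceil _
  have h0 : 0 ≤ 1 / g0 ^ 2 := by positivity
  push_cast at hle
  linarith

end End

end Summit.QuantumFields.YangMills.Theorems.BalabanUVNodesK1WindowKOfRunRowsSurvivors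

end
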